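import Mathlib
import Summits.ValiantsHypothesis.ValiantsHypothesis.Theorems.LiouvilleSarnakAlignedCutRank
import Summits.ValiantsHypothesis.ValiantsHypothesis.Theorems.LiouvilleSarnakLiouvilleCutRankSignPatternsTools
import Summits.ValiantsHypothesis.ValiantsHypothesis.Theorems.LiouvilleSarnakLiouvilleCutRankPeriodicEngine
import HarnessLib

/-!
# Route LiouvilleSarnak — crux `LiouvilleCutRank` (stmt-ValiantsHypothesis-14775):
# the block-interleaved cut family `(CCRR)^m` has UNBOUNDED rank (second Class A family, prime `5`)

`Theorems/LiouvilleSarnakLiouvilleCutRankInterleavedUnbounded.lean` settled `(CR)^n` with the prime `3`;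
`Theorems/LiouvilleSarnakLiouvilleCutRankPeriodicEngine.lean` isolated the periodic saturation engine.  This file
runs the engine on the next bounded-run family of the census, the cut words `(CCRR)^m` (column bits at positions
`≡ 0, 1 (mod 4)`, row bits at positions `≡ 2, 3 (mod 4)`; level `n = 2m`), where the saturation period `L` is
genuinely needed and the odd prime is `5 = 2^2 + 1`:

* §1 `spread4_step`, `spread4_ofBits` — the base-`4 → 16` digit spreading `E(y) = ofDigits 16 (digits 4 y)`:
  `E(4y + d) = 16 E(y) + d`, and `E(ofBits c) = Σ_i [c i] 2^{4⌊i/2⌋ + (i mod 2)}` (two bits per block of four).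
* §2 `infinite_rows_ccrr` — for `A x y = λ(1 + 4 E(x) + E(y))`: `A (4x+3) (4y+3) = A x y` (`λ(16 m) = λ(m)`), so
  by the engine finitely many rows would give `L ≥ 1` with row `4^L - 1` = row `0`; but at the column
  `y = 4^L - 2` one has `1 + 4E(4^L-1) + E(4^L-2) = 5 · (1 + E(4^L-2))`, `λ(5) = -1` — contradiction.  Hence
  the infinite `(CCRR)`-cut matrix of `λ` has infinitely many distinct rows.
* §3 ★ `ccrrCutRank` — `∀ W, ∃ n₀, ∀ n ≥ n₀`, every cut `π` of the `(CCRR)` shape at level `n` has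
  `W ≤ rank M_π`; `exists_ccrrCut` — such cuts exist at every even level.

Honest framing: one more explicit family of the crux (the bounded-run Class A of the census), proved
unconditionally and elementarily; the crux `LiouvilleCutRank` (ALL balanced cuts), `DigitalBilinearLiouville`,
`AlgebraicSarnak` stay OPEN; nothing bears on `VP ≠ VNP`.  No definitions (the spreading map is the explicit term
`Nat.ofDigits 16 (Nat.digits 4 y)`).
-/

set_option linter.dupNamespace false

noncomputable section

namespace Summit.ValiantsHypothesis.ValiantsHypothesis.Theorems.LiouvilleSarnakLiouvilleCutRank.CcrrUnbounded

open ArithmeticFunction Finset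

open Summit.ValiantsHypothesis.ValiantsHypothesis.Theorems.LiouvilleSarnakAligned
  (card_image_row_le_two_pow_rank)
open Summit.ValiantsHypothesis.ValiantsHypothesis.Theorems.LiouvilleSarnakLiouvilleCutRank.SignPatterns
  (ofBits_cut_eq_add ofBits_rows_eq_sum ofBits_cols_eq_sum)
open Summit.ValiantsHypothesis.ValiantsHypothesis.Theorems.LiouvilleSarnakLiouvilleCutRank.PeriodicEngine
  (exists_iterate_rows_eq)

/-! ### §1 The base-`4 → 16` spreading map -/

/-- `E(4y + d) = 16 E(y) + d` for `d < 4`, where `E(y) = ofDigits 16 (digits 4 y)`. [folklore] -/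
theorem spread4_step (y d : ℕ) (hd : d < 4) :
    Nat.ofDigits 16 (Nat.digits 4 (4 * y + d)) = 16 * Nat.ofDigits 16 (Nat.digits 4 y) + d := by
  rcases Nat.eq_zero_or_pos (4 * y + d) with h0 | hpos
  · have hy : y = 0 := by omega
    have hd0 : d = 0 := by omega
    subst hy; subst hd0
    simp
  · rw [Nat.digits_def' (by norm_num : 1 < 4) hpos, Nat.ofDigits_cons]
    have h1 : (4 * y + d) % 4 = d := by omega
    have h2 : (4 * y + d) / 4 = y := by omega
    rw [h1, h2]
    ring

/-- `E(0) = 0`. [folklore] -/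
theorem spread4_zero : Nat.ofDigits 16 (Nat.digits 4 0) = 0 := by simp

/-- `E(ofBits c) = Σ_i [c i] · 2^{4⌊i/2⌋ + (i mod 2)}`: bit `i` of `ofBits c` is digit-position `⌊i/2⌋`, bit
`i mod 2` inside the base-`4` digit, which `E` places at binary position `4⌊i/2⌋ + (i mod 2)`. [folklore] -/
theorem spread4_ofBits : ∀ (n : ℕ) (c : Fin n → Bool),
    Nat.ofDigits 16 (Nat.digits 4 (Nat.ofBits c)) = ∑ i : Fin n, (c i).toNat * 2 ^ (4 * ((i : ℕ) / 2) + (i : ℕ) % 2) := by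
  intro n
  induction n using Nat.twoStepInduction with
  | zero => intro c; simp
  | one =>
    intro c
    rw [Nat.ofBits_succ, Nat.ofBits_zero, Fin.sum_univ_succ]
    simp only [mul_zero, zero_add, Fin.val_zero, Nat.zero_div, Nat.zero_mod, add_zero, pow_zero, mul_one,
      Finset.univ_eq_empty, Finset.sum_empty]
    cases c 0 <;> simp
  | more n ih _ =>
    intro c
    have hsplit : Nat.ofBits c = 4 * Nat.ofBits ((c ∘ Fin.succ) ∘ Fin.succ) + ((c 0).toNat + 2 * (c 1).toNat) := by
      rw [Nat.ofBits_succ, Nat.ofBits_succ]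
      simp only [Function.comp_apply, Fin.succ_zero_eq_one]
      ring
    have hd : (c 0).toNat + 2 * (c 1).toNat < 4 := by
      cases c 0 <;> cases c 1 <;> simp
    rw [hsplit, spread4_step _ _ hd, ih ((c ∘ Fin.succ) ∘ Fin.succ)]
    rw [Fin.sum_univ_succ, Fin.sum_univ_succ]
    simp only [Fin.val_zero, Nat.zero_div, mul_zero, Nat.zero_mod, add_zero, pow_zero, mul_one,
      Fin.val_succ, Function.comp_apply, Fin.succ_zero_eq_one]
    have htail : (∑ i : Fin n, (c i.succ.succ).toNat * 2 ^ (4 * (((i : ℕ) + 1 + 1) / 2) + ((i : ℕ) + 1 + 1) % 2)) =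
        16 * ∑ i : Fin n, (c i.succ.succ).toNat * 2 ^ (4 * ((i : ℕ) / 2) + (i : ℕ) % 2) := by
      rw [Finset.mul_sum]
      refine Finset.sum_congr rfl fun i _ => ?_
      have h1 : ((i : ℕ) + 1 + 1) / 2 = (i : ℕ) / 2 + 1 := by omega
      have h2 : ((i : ℕ) + 1 + 1) % 2 = (i : ℕ) % 2 := by omega
      rw [h1, h2, show 4 * ((i : ℕ) / 2 + 1) + (i : ℕ) % 2 = (4 * ((i : ℕ) / 2) + (i : ℕ) % 2) + 4 by ring,
        pow_add]
      ring
    rw [htail]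
    have hv1 : ((1 : Fin (n + 2)) : ℕ) = 1 := rfl
    rw [hv1, show (1 : ℕ) / 2 * 4 = 0 by norm_num, show (1 : ℕ) % 2 = 1 by norm_num, zero_add, pow_one]
    ring

/-! ### §2 The infinite `(CCRR)` matrix of `λ` has infinitely many rows -/

/-- `λ(5 m) = -λ(m)` and `λ(16 m) = λ(m)`. [folklore] -/
theorem liouville_five_sixteen (m : ℕ) : liouville (5 * m) = -liouville m ∧ liouville (16 * m) = liouville m := by
  have h2 : liouville 2 = -1 := by
    rw [liouville_apply two_ne_zero, cardFactors_apply_prime Nat.prime_two]; norm_num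
  have h5 : liouville 5 = -1 := by
    rw [liouville_apply (by norm_num), cardFactors_apply_prime (by norm_num : Nat.Prime 5)]; norm_num
  have h4 : liouville 4 = 1 := by
    rw [show (4 : ℕ) = 2 * 2 by norm_num, liouville_apply_mul, h2]; norm_num
  have h16 : liouville 16 = 1 := by
    rw [show (16 : ℕ) = 4 * 4 by norm_num, liouville_apply_mul, h4]; norm_num
  refine ⟨?_, ?_⟩
  · rw [liouville_apply_mul, h5]; ring
  · rw [liouville_apply_mul, h16]; ring

/-- `(x ↦ 4x + 3)^[L] 0 = 4^L - 1`. [folklore] -/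
theorem iterate_four_mul_add_three (L : ℕ) : (fun x : ℕ => 4 * x + 3)^[L] 0 = 4 ^ L - 1 := by
  induction L with
  | zero => simp
  | succ L ih =>
    rw [Function.iterate_succ_apply', ih]
    have h : 1 ≤ 4 ^ L := Nat.one_le_pow _ _ (by norm_num)
    rw [pow_succ]
    omega

/-- ★ **Infinitely many rows for `(CCRR)`.**  With `E(y) = ofDigits 16 (digits 4 y)`, the rows
`y ↦ λ(1 + 4E(x) + E(y))`, `x ∈ ℕ` — the rows of the infinite `(CCRR)`-cut matrix of `λ` — form an infinite set:
otherwise the periodic engine (`A (4x+3) (4y+3) = A x y` as `λ(16m) = λ(m)`) gives `L ≥ 1` with row `4^L-1` = row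
`0`, contradicted at the column `4^L - 2`, where `1 + 4E(4^L-1) + E(4^L-2) = 5 (1 + E(4^L-2))` and `λ(5) = -1`.
[this file] -/
theorem infinite_rows_ccrr :
    (Set.range fun x y : ℕ => liouville (1 + 4 * Nat.ofDigits 16 (Nat.digits 4 x) + Nat.ofDigits 16 (Nat.digits 4 y))).Infinite := by
  intro hfin
  have hF : ∀ x y : ℕ, liouville (1 + 4 * Nat.ofDigits 16 (Nat.digits 4 (4 * x + 3)) +
      Nat.ofDigits 16 (Nat.digits 4 (4 * y + 3))) =
      1 * liouville (1 + 4 * Nat.ofDigits 16 (Nat.digits 4 x) + Nat.ofDigits 16 (Nat.digits 4 y)) := by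
    intro x y
    rw [spread4_step x 3 (by norm_num), spread4_step y 3 (by norm_num), one_mul,
      show 1 + 4 * (16 * Nat.ofDigits 16 (Nat.digits 4 x) + 3) + (16 * Nat.ofDigits 16 (Nat.digits 4 y) + 3) =
        16 * (1 + 4 * Nat.ofDigits 16 (Nat.digits 4 x) + Nat.ofDigits 16 (Nat.digits 4 y)) by ring]
    exact (liouville_five_sixteen _).2
  obtain ⟨L, hL1, hL⟩ := exists_iterate_rows_eq
    (fun x y : ℕ => liouville (1 + 4 * Nat.ofDigits 16 (Nat.digits 4 x) + Nat.ofDigits 16 (Nat.digits 4 y)))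
    (fun x => 4 * x + 3) (fun y => 4 * y + 3) 1 (by norm_num) hF hfin
  -- row `4^L - 1` equals row `0`; evaluate at the column `4^L - 2 = 4 z + 2`, `4^L - 1 = 4 z + 3`
  have hrow := hL 0
  rw [iterate_four_mul_add_three] at hrow
  obtain ⟨z, hz⟩ : ∃ z : ℕ, 4 ^ L = 4 * z + 4 := by
    obtain ⟨L', rfl⟩ := Nat.exists_eq_add_of_le hL1
    refine ⟨4 ^ L' - 1, ?_⟩
    have h : 1 ≤ 4 ^ L' := Nat.one_le_pow _ _ (by norm_num)
    rw [pow_add, pow_one]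
    omega
  have ht : 4 ^ L - 1 = 4 * z + 3 := by omega
  have h1 := congrFun hrow (4 * z + 2)
  rw [ht, spread4_step z 3 (by norm_num), spread4_step z 2 (by norm_num), spread4_zero] at h1
  rw [show 1 + 4 * (16 * Nat.ofDigits 16 (Nat.digits 4 z) + 3) + (16 * Nat.ofDigits 16 (Nat.digits 4 z) + 2) =
      5 * (1 + 4 * 0 + (16 * Nat.ofDigits 16 (Nat.digits 4 z) + 2)) by ring] at h1
  rw [(liouville_five_sixteen _).1] at h1
  have hne : liouville (1 + 4 * 0 + (16 * Nat.ofDigits 16 (Nat.digits 4 z) + 2)) ≠ 0 :=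
    liouville_ne_zero (by omega)
  exact hne (by linarith)

/-! ### §3 The `(CCRR)^m` cut family has unbounded rank -/

/-- For a cut of `(CCRR)` shape (row bit `i` at position `4⌊i/2⌋ + (i mod 2) + 2`, column bit `i` at
position `4⌊i/2⌋ + (i mod 2)`): `N_π(r, c) = 4 E(ofBits r) + E(ofBits c)`. [this file] -/
theorem cutNumber_ccrr (n : ℕ) (π : Fin n ⊕ Fin n ≃ Fin (2 * n))
    (hπ : ∀ i : Fin n, (π (Sum.inl i) : ℕ) = 4 * ((i : ℕ) / 2) + (i : ℕ) % 2 + 2 ∧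
      (π (Sum.inr i) : ℕ) = 4 * ((i : ℕ) / 2) + (i : ℕ) % 2)
    (r c : Fin n → Bool) :
    Nat.ofBits (fun j : Fin (2 * n) => Sum.elim r c (π.symm j)) =
      4 * Nat.ofDigits 16 (Nat.digits 4 (Nat.ofBits r)) + Nat.ofDigits 16 (Nat.digits 4 (Nat.ofBits c)) := by
  rw [ofBits_cut_eq_add, ofBits_rows_eq_sum, ofBits_cols_eq_sum, spread4_ofBits, spread4_ofBits,
    Finset.mul_sum]
  congr 1
  · refine Finset.sum_congr rfl fun i _ => ?_
    rw [(hπ i).1, pow_add]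
    ring
  · refine Finset.sum_congr rfl fun i _ => ?_
    rw [(hπ i).2]

/-- ★★ **The `(CCRR)^m` cut family has unbounded rank.**  For every `W` there is `n₀` such that for all
`n ≥ n₀`, every cut `π` of `(CCRR)` shape at level `n` has cut matrix `M_π(r,c) = λ(N_π(r,c) + 1)` of rank `≥ W`.
(`2^W` pairwise distinct infinite rows of `infinite_rows_ccrr` are separated at finitely many columns, hence give
`2^W` distinct rows of `M_π` at all large levels, and `#rows ≤ 2^{rank}`.) [this file] -/
theorem ccrrCutRank (W : ℕ) : ∃ n₀ : ℕ, ∀ n ≥ n₀, ∀ π : Fin n ⊕ Fin n ≃ Fin (2 * n),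
    (∀ i : Fin n, (π (Sum.inl i) : ℕ) = 4 * ((i : ℕ) / 2) + (i : ℕ) % 2 + 2 ∧
      (π (Sum.inr i) : ℕ) = 4 * ((i : ℕ) / 2) + (i : ℕ) % 2) →
      W ≤ (Matrix.of fun r c : Fin n → Bool =>
        (((liouville (Nat.ofBits (fun k : Fin (2 * n) => Sum.elim r c (π.symm k)) + 1) : ℤ) : ℂ))).rank := by
  classical
  have hinf := infinite_rows_ccrr
  obtain ⟨T, hTsub, hTcard⟩ := hinf.exists_subset_card_eq (2 ^ W)
  have hrep : ∀ ρ ∈ T, ∃ x : ℕ, (fun y => liouville (1 + 4 * Nat.ofDigits 16 (Nat.digits 4 x) +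
      Nat.ofDigits 16 (Nat.digits 4 y))) = ρ := fun ρ hρ => hTsub (Finset.mem_coe.mpr hρ)
  choose! X hX using hrep
  have hsep : ∀ ρ ∈ T, ∀ ρ' ∈ T, ρ ≠ ρ' → ∃ y : ℕ, ρ y ≠ ρ' y := fun ρ _ ρ' _ h =>
    Function.ne_iff.mp h
  choose! Y hY using hsep
  refine ⟨T.sup X + T.sup (fun ρ => T.sup (Y ρ)) + 1, fun n hn π hπ => ?_⟩
  have h2n : T.sup X + T.sup (fun ρ => T.sup (Y ρ)) < 2 ^ n :=
    lt_of_lt_of_le (lt_of_lt_of_le (Nat.lt_succ_self _) hn) (Nat.lt_two_pow_self).le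
  have hXlt : ∀ ρ ∈ T, X ρ < 2 ^ n := fun ρ hρ =>
    lt_of_le_of_lt ((Finset.le_sup (f := X) hρ).trans (Nat.le_add_right _ _)) h2n
  have hYlt : ∀ ρ ∈ T, ∀ ρ' ∈ T, Y ρ ρ' < 2 ^ n := fun ρ hρ ρ' hρ' =>
    lt_of_le_of_lt (((Finset.le_sup (f := Y ρ) hρ').trans
      (Finset.le_sup (f := fun ρ => T.sup (Y ρ)) hρ)).trans (Nat.le_add_left _ _)) h2n
  set M := (Matrix.of fun r c : Fin n → Bool =>
      (((liouville (Nat.ofBits (fun k : Fin (2 * n) => Sum.elim r c (π.symm k)) + 1) : ℤ) : ℂ)))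
    with hM
  have hpm : ∀ r c, M r c = 1 ∨ M r c = -1 := by
    intro r c
    rw [hM, Matrix.of_apply, liouville_apply (Nat.succ_ne_zero _)]
    rcases neg_one_pow_eq_or ℤ
        (cardFactors (Nat.ofBits (fun k : Fin (2 * n) => Sum.elim r c (π.symm k)) + 1)) with h | h
    · left; rw [h]; norm_num
    · right; rw [h]; norm_num
  have hbits : ∀ x < 2 ^ n, Nat.ofBits (fun i : Fin n => x.testBit i) = x := fun x hx => by
    rw [Nat.ofBits_testBit, Nat.mod_eq_of_lt hx]
  have hentry : ∀ x < 2 ^ n, ∀ y < 2 ^ n,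
      M (fun i : Fin n => x.testBit i) (fun i : Fin n => y.testBit i) =
        ((liouville (1 + 4 * Nat.ofDigits 16 (Nat.digits 4 x) + Nat.ofDigits 16 (Nat.digits 4 y)) : ℤ) : ℂ) := by
    intro x hx y hy
    rw [hM, Matrix.of_apply, cutNumber_ccrr n π hπ, hbits x hx, hbits y hy,
      show 4 * Nat.ofDigits 16 (Nat.digits 4 x) + Nat.ofDigits 16 (Nat.digits 4 y) + 1 =
        1 + 4 * Nat.ofDigits 16 (Nat.digits 4 x) + Nat.ofDigits 16 (Nat.digits 4 y) by ring]
  have hinj : Set.InjOn (fun ρ : ℕ → ℤ => M (fun i : Fin n => (X ρ).testBit i)) ↑T := by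
    intro ρ hρ ρ' hρ' h
    by_contra hne
    have h1 := congrFun h (fun i : Fin n => (Y ρ ρ').testBit i)
    simp only at h1
    rw [hentry _ (hXlt ρ hρ) _ (hYlt ρ hρ ρ' hρ'), hentry _ (hXlt ρ' hρ') _ (hYlt ρ hρ ρ' hρ')] at h1
    have h2 : liouville (1 + 4 * Nat.ofDigits 16 (Nat.digits 4 (X ρ)) + Nat.ofDigits 16 (Nat.digits 4 (Y ρ ρ'))) =
        liouville (1 + 4 * Nat.ofDigits 16 (Nat.digits 4 (X ρ')) + Nat.ofDigits 16 (Nat.digits 4 (Y ρ ρ'))) := by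
      exact_mod_cast h1
    have h3 := congrFun (hX ρ hρ) (Y ρ ρ')
    have h4 := congrFun (hX ρ' hρ') (Y ρ ρ')
    rw [h3, h4] at h2
    exact hY ρ hρ ρ' hρ' hne h2
  have hcard : T.card ≤ (Finset.univ.image fun r : Fin n → Bool => M r).card := by
    calc T.card = (T.image fun ρ : ℕ → ℤ => M (fun i : Fin n => (X ρ).testBit i)).card :=
          (Finset.card_image_of_injOn hinj).symm
      _ ≤ (Finset.univ.image fun r : Fin n → Bool => M r).card := by
          refine Finset.card_le_card fun v hv => ?_
          obtain ⟨ρ, -, rfl⟩ := Finset.mem_image.mp hv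
          exact Finset.mem_image.mpr ⟨_, Finset.mem_univ _, rfl⟩
  have hrank := card_image_row_le_two_pow_rank M hpm
  have hle : 2 ^ W ≤ 2 ^ M.rank := hTcard ▸ hcard.trans hrank
  exact (Nat.pow_le_pow_iff_right (by norm_num)).mp hle

/-- Cuts of `(CCRR)` shape exist at every even level `n = 2m` (non-vacuity of `ccrrCutRank`). [this file] -/
theorem exists_ccrrCut (m : ℕ) : ∃ π : Fin (2 * m) ⊕ Fin (2 * m) ≃ Fin (2 * (2 * m)),
    ∀ i : Fin (2 * m), (π (Sum.inl i) : ℕ) = 4 * ((i : ℕ) / 2) + (i : ℕ) % 2 + 2 ∧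
      (π (Sum.inr i) : ℕ) = 4 * ((i : ℕ) / 2) + (i : ℕ) % 2 := by
  let f : Fin (2 * m) ⊕ Fin (2 * m) → Fin (2 * (2 * m)) := fun x =>
    Sum.elim (fun i : Fin (2 * m) => (⟨4 * ((i : ℕ) / 2) + (i : ℕ) % 2 + 2, by omega⟩ : Fin (2 * (2 * m))))
      (fun i : Fin (2 * m) => (⟨4 * ((i : ℕ) / 2) + (i : ℕ) % 2, by omega⟩ : Fin (2 * (2 * m)))) x
  have hinj : Function.Injective f := by
    rintro (i | i) (i' | i') h <;>
      simp only [f, Sum.elim_inl, Sum.elim_inr, Fin.mk.injEq] at h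
    · have : i = i' := Fin.ext (by omega)
      rw [this]
    · omega
    · omega
    · have : i = i' := Fin.ext (by omega)
      rw [this]
  have hbij : Function.Bijective f := by
    rw [Fintype.bijective_iff_injective_and_card]
    refine ⟨hinj, ?_⟩
    simp only [Fintype.card_sum, Fintype.card_fin]
    ring
  refine ⟨Equiv.ofBijective f hbij, fun i => ⟨?_, ?_⟩⟩
  · simp [Equiv.ofBijective_apply, f]
  · simp [Equiv.ofBijective_apply, f]

/-- Corollary in the quantifier shape of the crux restricted to this family: eventually, at every EVEN level,
the `(CCRR)` cut exists and has rank `≥ W`. [this file] -/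
theorem ccrrCutRank_exists (W : ℕ) : ∃ n₀ : ℕ, ∀ m : ℕ, n₀ ≤ 2 * m →
    ∃ π : Fin (2 * m) ⊕ Fin (2 * m) ≃ Fin (2 * (2 * m)),
      (∀ i : Fin (2 * m), (π (Sum.inl i) : ℕ) = 4 * ((i : ℕ) / 2) + (i : ℕ) % 2 + 2 ∧
        (π (Sum.inr i) : ℕ) = 4 * ((i : ℕ) / 2) + (i : ℕ) % 2) ∧
      W ≤ (Matrix.of fun r c : Fin (2 * m) → Bool =>
        (((liouville (Nat.ofBits (fun k : Fin (2 * (2 * m)) => Sum.elim r c (π.symm k)) + 1) : ℤ) : ℂ))).rank := by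
  obtain ⟨n₀, hn₀⟩ := ccrrCutRank W
  refine ⟨n₀, fun m hm => ?_⟩
  obtain ⟨π, hπ⟩ := exists_ccrrCut m
  exact ⟨π, hπ, hn₀ (2 * m) hm π hπ⟩

end Summit.ValiantsHypothesis.ValiantsHypothesis.Theorems.LiouvilleSarnakLiouvilleCutRank.CcrrUnbounded

end
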